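/-
Copyright (c) 2026 the pub-hodgecm-mathlib formalisation cell (harness21).  Prover seat hodgecm-mathlib-K2Liu-p06 (g3): Track B «K2-LIT»,
hLiu418 = stmt-HodgeConjecture-24832, LEAD F0P6-plan (g12) words 2026-09-04T06:45:31Z «(ii) B2c Bruhat EXHAUSTION» and 06:51:40Z «= FACE (X) POINTWISE»;
2026-09-04.
-/
import Summits.HodgeConjecture.HodgeConjecture.Theorems.K2LiuSiegelBruhatRankNormalForm     -- ★ (X1) normal form, (X3) frame factorisation
import Summits.HodgeConjecture.HodgeConjecture.Theorems.K2LiuSiegelDoubledRationalFrames    -- ★ (X2) rational frames, sign involutions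
import Summits.HodgeConjecture.HodgeConjecture.Theorems.K2LiuSiegelBruhatCellsDelta        -- ★ frame unitarity, adelic big cell
import Summits.HodgeConjecture.HodgeConjecture.Theorems.K2LiuWeylDeltaRational             -- ★ `weylDelta_mem_ratH`
import HarnessLib

/-!
# Crux `HLiu418`, ROAD Φ ∕ organ O41.1 B2c: THE BRUHAT EXHAUSTION `H(L⁺) = ⨆_χ P_Δ(L⁺) · w_χ · P_Δ(L⁺)` — POINTWISE FACE (X):
# every rational `γ` off the big cell is `p · ι(1, diag(1 − 2χ)) · p'` with `p, p' ∈ P_Δ(L⁺)` and a `0∕1` pattern `χ ≢ 1`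

Cell `hodgecm-mathlib`, crux item hLiu418 = `stmt-HodgeConjecture-24832`, route `HCCMUnconditional`; squad K2 ∕ K2Liu, LEAD F0P6-plan (g12) (word 06:51:40Z
«= FACE (X) POINTWISE … then REST = ⊔ orbits of [w_g m]»), dealer K2E5-plan (g5) (scope note 06:51:52Z: the socket pins `n = 2`; general `n` kept, it is free
here), prover K2Liu-p06 (g3).  THEOREMS ONLY; lane `--supports stmt-HodgeConjecture-24832 --as helper` (count-neutral).

THE ARGUMENT (general `n`, no Witt theory, no induction).  Let `γ ∈ H(L⁺)` with frame `F = E₁ · blk γ · E₂ = (A B; C D)` (★ `conjE_eq`), `C ∈ M_n(L)`.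
(X1) ★ `exists_mul_mul_eq_neg_two_smul_diagonal`: `d₀ C a₀ = −2·diag(χ)` over the FIELD `L` with `d₀, a₀ ∈ GL_n(L)`, `χ ∈ {0,1}ⁿ` (and `χ ≢ 1` when `det C`
is not a unit ★ `exists_apply_eq_zero_of_not_isUnit`).  (X2) ★ `exists_rat_siegel_frame₂₂ ∕ ₁₁`: rational `m₁, m₂ ∈ P_Δ(L⁺)` with frames `(⋆ ⋆; 0 d₀)`,
`(a₀ ⋆; 0 ⋆)`, so `γ' := m₁ γ m₂` has `C(γ') = d₀ C a₀ = −2E`, `E = diag(χ ⊗ 1)` (★ Part A `C ↦ d C a`): **`exists_siegel_conj_normalForm`**.  (X3) for a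
UNITARY frame with `C = −2E` (★ `frame_blk_unitary`), ★ `corner_mul_eq_zero_of_unitary` ∕ `skew_half_corner_of_unitary` ∕
`toBlocks₂₁_reflFrame_mul_unip_mul_eq_zero`: with the rational `T`-skew `X = ⅟2(EAE − E)` and `u = n(X) ∈ N_Δ(L⁺)` (★ `exists_mem_HA_of_cstar`,
★ `mem_ratH_of_frame_eq_map`), `w_χ · u · γ' ∈ P_Δ` where `w_χ = ι(1, diag(1 − 2χ∘e) ⊗ 1)` has frame `W_E` (★ `frame_iotaGG_signInvolution`); as `w_χ² = 1`,
`γ' = u⁻¹ · w_χ · (w_χ u γ')`: **`exists_unip_refl_siegel_of_normalForm`**.  Assembling, **`exists_siegel_mul_refl_mul_siegel`**: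
`γ = (m₁⁻¹ u⁻¹) · w_χ · (w_χ u γ' m₂⁻¹)`, both outer factors rational and Siegel — the face the Φ2 assembly consumes (★ Φ2 files 3–6 kill every orbit
`[w_χ p' ν]`, `ν ∈ N_Δ(L⁺)`, for `det S ≠ 0` once `χ` has a zero entry; `one_sub_reindex_signInvolution`: `1 − G = 2·diag(χ ⊗ 1)` bridges to their corner
condition `diag(χ) X diag(χ) = 0`).  `exists_apply_eq_one_of_not_isSiegelDelta`: `γ ∉ P_Δ ⇒ χ ≢ 0` (`w_χ ≠ 1`).  Finally **`exists_rat_siegel_weylDelta_unip`**: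
the RATIONAL big cell — `det C ∈ 𝔸ˣ` ⇒ `γ = p · w_Δ · ν` with `p ∈ P_Δ(L⁺)`, `ν ∈ N_Δ(L⁺)` (★ adelic `exists_siegel_weylDelta_unip` + rationality of the
explicit coordinate `X = C⁻¹D − ⅟2`), i.e. the cosets outside `{[1]} ∪ [w_Δ N_Δ(L⁺)]` are exactly those with `det C = 0 ≠ C`.
[GelbartPiatetskishapiroRallis1987, Part A §§1–2 (P\H/P ↔ rank C)], [KudlaRallis1994, §1], [MoeglinWaldspurger1995, II.1.7].

HONEST LABEL.  Count-neutral helper; `HC_CM` is proved only modulo the 7 printed citations (2 remaining named inputs: hLiu418 = `stmt-HodgeConjecture-24832`,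
h413 = `stmt-HodgeConjecture-24833`) until rung 0 closes.
-/

set_option autoImplicit false
set_option linter.dupNamespace false -- the mandated namespace repeats `HodgeConjecture.HodgeConjecture`

noncomputable section

open scoped Matrix Kronecker
open NumberField IsDedekindDomain
open Literature.NumberTheory.Automorphic Literature.NumberTheory.Automorphic.UnitaryGroup
open Literature.NumberTheory.GelbartRogawski1991 Literature.NumberTheory.GelbartRogawski1991.GRConstruction
open Literature.NumberTheory.K2Lit.SiegelDoubled
open UnitaryDualPair

namespace Summit.HodgeConjecture.HodgeConjecture.Cruxes.HLiu418.K2LiuSiegelBruhatMiddleCellExhaustion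

open K2LiuSiegelDoubledBlkUnitary K2LiuSiegelDoubledRationalPoints K2LiuSiegelDoubledLeviMatrix
open K2LiuSiegelBruhatCells K2LiuSiegelBruhatCellsUnitary K2LiuSiegelBruhatCellsDelta K2LiuSiegelBruhatMiddleCellDelta
open K2LiuSiegelBruhatRankNormalForm K2LiuSiegelDoubledRationalFrames K2LiuWeylDeltaRational

variable (L : Type) [Field L] [NumberField L] [IsCMField L]
variable {N M n : ℕ} (e : Fin N × Fin M ≃ Fin n)
  (dV : Fin N → L) (hdV : ∀ i, IsCMField.complexConj L (dV i) = dV i)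
  (dW : Fin M → L) (hdW : ∀ i, IsCMField.complexConj L (dW i) = dW i)

/-! ## §1 The corner idempotent `E = diag(χ ⊗ 1)` of a `0∕1` pattern -/

omit [IsCMField L] in
/-- `χ ⊗ 1` is again a `0∕1` pattern. [folklore] -/
theorem pattern_map {χ : Fin n → L} (hχ : ∀ k, χ k = 0 ∨ χ k = 1) (k : Fin n) :
    algebraMap L (AdeleRing (𝓞 L) L) (χ k) = 0 ∨ algebraMap L (AdeleRing (𝓞 L) L) (χ k) = 1 := by
  rcases hχ k with h | h
  · exact Or.inl (by rw [h, map_zero])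
  · exact Or.inr (by rw [h, map_one])

/-- **the corner idempotent**: `E = diag(χ ⊗ 1)` satisfies `E² = E`, `σ(E) = E`, `Eᵀ = E` and commutes with the (diagonal) Gram matrix `T_𝔸`.
[cite: GelbartRogawski1991, §3.1 Prop. 3.1.1 p. 455 L1–2] -/
theorem cornerIdem_facts {χ : Fin n → L} (hχ : ∀ k, χ k = 0 ∨ χ k = 1) :
    Matrix.diagonal (fun i => algebraMap L (AdeleRing (𝓞 L) L) (χ i)) * Matrix.diagonal (fun i => algebraMap L (AdeleRing (𝓞 L) L) (χ i)) =
        Matrix.diagonal (fun i => algebraMap L (AdeleRing (𝓞 L) L) (χ i)) ∧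
      (Matrix.diagonal (fun i => algebraMap L (AdeleRing (𝓞 L) L) (χ i))).map (conjAdele (Fp L) L (IsCMField.complexConj L)) =
        Matrix.diagonal (fun i => algebraMap L (AdeleRing (𝓞 L) L) (χ i)) ∧
      (Matrix.diagonal (fun i => algebraMap L (AdeleRing (𝓞 L) L) (χ i)))ᵀ = Matrix.diagonal (fun i => algebraMap L (AdeleRing (𝓞 L) L) (χ i)) ∧
      Matrix.diagonal (fun i => algebraMap L (AdeleRing (𝓞 L) L) (χ i)) *
          (gramR L e dV hdV dW hdW).map ((algebraMap L (AdeleRing (𝓞 L) L)).comp (algebraMap (Fp L) L)) =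
        (gramR L e dV hdV dW hdW).map ((algebraMap L (AdeleRing (𝓞 L) L)).comp (algebraMap (Fp L) L)) *
          Matrix.diagonal (fun i => algebraMap L (AdeleRing (𝓞 L) L) (χ i)) := by
  have hd := pattern_map L hχ
  refine ⟨?_, ?_, Matrix.diagonal_transpose _, ?_⟩
  · rw [Matrix.diagonal_mul_diagonal]
    congr 1; funext k
    rcases hd k with h | h <;> simp [h]
  · rw [Matrix.diagonal_map (map_zero _)]
    congr 1; funext k
    show conjAdele (Fp L) L (IsCMField.complexConj L) (algebraMap L (AdeleRing (𝓞 L) L) (χ k)) = _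
    rcases hd k with h | h
    · rw [h, map_zero]
    · rw [h, map_one]
  · -- `T = gramR` is diagonal: `reindex e e (diag dV ⊗ diag dW)`
    have hT : ∃ t : Fin n → Fp L, gramR L e dV hdV dW hdW = Matrix.diagonal t := by
      refine ⟨(fun mn : Fin N × Fin M => (⟨dV mn.1, (IsCMField.complexConj_eq_self_iff (K := L) (dV mn.1)).1 (hdV mn.1)⟩ : Fp L) *
        (⟨dW mn.2, (IsCMField.complexConj_eq_self_iff (K := L) (dW mn.2)).1 (hdW mn.2)⟩ : Fp L)) ∘ e.symm, ?_⟩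
      unfold gramR gram realDiagonal
      rw [Matrix.diagonal_kronecker_diagonal, Matrix.reindex_apply, Matrix.submatrix_diagonal_equiv]
    obtain ⟨t, ht⟩ := hT
    rw [ht, Matrix.diagonal_map (map_zero _), Matrix.diagonal_mul_diagonal, Matrix.diagonal_mul_diagonal]
    congr 1; funext k
    exact mul_comm _ _

/-! ## §2 (X1)+(X2): conjugating a rational element into `C`-normal form by rational Siegel elements -/

/-- **normal form of the `C`-block by rational Siegel elements**: for `γ ∈ H(L⁺)` there are a `0∕1` pattern `χ` and `m₁, m₂ ∈ P_Δ(L⁺)` with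
`C(m₁ γ m₂) = −2·diag(χ ⊗ 1)`; if `det C(γ)` is not a unit then `χ` has a zero entry.  ((X1) over the field `L` on the rational frame ★
`exists_frame_eq_map_of_mem_ratH`, transported by the Levi elements of ★ `exists_rat_siegel_frame₂₂ ∕ ₁₁` and ★ Part A `C(p M p') = d C a'`.)
[cite: GelbartPiatetskishapiroRallis1987, Part A §1] [cite: MoeglinWaldspurger1995, II.1.7] -/
theorem exists_siegel_conj_normalForm (hdV0 : ∀ i, dV i ≠ 0) (hdW0 : ∀ i, dW i ≠ 0) {γ : HA L e dV hdV dW hdW} (hγ : γ ∈ ratH L e dV hdV dW hdW) :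
    ∃ (χ : Fin n → L) (m₁ m₂ : HA L e dV hdV dW hdW), (∀ k, χ k = 0 ∨ χ k = 1) ∧
      m₁ ∈ ratH L e dV hdV dW hdW ∧ IsSiegelDelta L e dV hdV dW hdW m₁ ∧ m₂ ∈ ratH L e dV hdV dW hdW ∧ IsSiegelDelta L e dV hdV dW hdW m₂ ∧
      (Matrix.fromBlocks (1 : Matrix (Fin n) (Fin n) (AdeleRing (𝓞 L) L)) 0 (-1) 1 * blk L e dV hdV dW hdW (m₁ * γ * m₂) * Matrix.fromBlocks 1 0 1 1).toBlocks₂₁ =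
        -((2 : AdeleRing (𝓞 L) L) • Matrix.diagonal (fun i => algebraMap L (AdeleRing (𝓞 L) L) (χ i))) ∧
      (¬ IsUnit (Matrix.fromBlocks (1 : Matrix (Fin n) (Fin n) (AdeleRing (𝓞 L) L)) 0 (-1) 1 * blk L e dV hdV dW hdW γ * Matrix.fromBlocks 1 0 1 1).toBlocks₂₁.det →
        ∃ k, χ k = 0) := by
  obtain ⟨F₀, hF₀⟩ := exists_frame_eq_map_of_mem_ratH L e dV hdV dW hdW hγ
  obtain ⟨d₀, a₀, χ, hd₀, ha₀, hχ, hnf⟩ := exists_mul_mul_eq_neg_two_smul_diagonal F₀.toBlocks₂₁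
  have hd₀u : IsUnit d₀ := (Matrix.isUnit_iff_isUnit_det d₀).2 hd₀
  have ha₀u : IsUnit a₀ := (Matrix.isUnit_iff_isUnit_det a₀).2 ha₀
  obtain ⟨m₁, hm₁r, hm₁P, a₁, b₁, hm₁⟩ := exists_rat_siegel_frame₂₂ L e dV hdV dW hdW hdV0 hdW0 hd₀u.unit
  obtain ⟨m₂, hm₂r, hm₂P, b₂, d₂, hm₂⟩ := exists_rat_siegel_frame₁₁ L e dV hdV dW hdW hdV0 hdW0 ha₀u.unit
  rw [hd₀u.unit_spec] at hm₁
  rw [ha₀u.unit_spec] at hm₂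
  have hFb : F₀.map (algebraMap L (AdeleRing (𝓞 L) L)) = Matrix.fromBlocks (F₀.toBlocks₁₁.map (algebraMap L (AdeleRing (𝓞 L) L)))
      (F₀.toBlocks₁₂.map (algebraMap L (AdeleRing (𝓞 L) L))) (F₀.toBlocks₂₁.map (algebraMap L (AdeleRing (𝓞 L) L)))
      (F₀.toBlocks₂₂.map (algebraMap L (AdeleRing (𝓞 L) L))) := by
    rw [← Matrix.fromBlocks_map, Matrix.fromBlocks_toBlocks]
  refine ⟨χ, m₁, m₂, hχ, hm₁r, hm₁P, hm₂r, hm₂P, ?_, fun hn => ?_⟩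
  · rw [conj_blk_mul, conj_blk_mul, hm₁, hm₂, hF₀, hFb]
    simp only [Matrix.fromBlocks_multiply, Matrix.toBlocks_fromBlocks₂₁, Matrix.zero_mul, zero_add, Matrix.mul_zero, add_zero]
    rw [← Matrix.map_mul, ← Matrix.map_mul, hnf, Matrix.map_neg _ (map_neg _),
      Matrix.map_smulₛₗ _ _ (2 : L) (fun a => by rw [smul_eq_mul, smul_eq_mul, map_mul]) _, map_ofNat, Matrix.diagonal_map (map_zero _)]
  · refine exists_apply_eq_zero_of_not_isUnit hχ hnf fun hu => hn ?_
    rw [hF₀, hFb, Matrix.toBlocks_fromBlocks₂₁]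
    have h := hu.map (algebraMap L (AdeleRing (𝓞 L) L))
    rwa [RingHom.map_det] at h

/-! ## §3 (X3): a rational element in `C`-normal form lies in `N_Δ(L⁺) · w_χ · P_Δ(L⁺)` -/

/-- **THE MIDDLE-CELL FACTORISATION in `H(𝔸)`**: if `γ ∈ H(L⁺)` has `C(γ) = −2·diag(χ ⊗ 1)` for a `0∕1` pattern `χ`, then
`γ = u · w_χ · p` with `u ∈ N_Δ(L⁺)`, `p ∈ P_Δ(L⁺)`, `w_χ = ι(1, γ_χ ⊗ 1)` for the rational sign involution `γ_χ = diag(1 − 2χ∘e)` (`γ_χ² = 1`).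
Proof: §2 of ★ `K2LiuSiegelBruhatRankNormalForm` on the unitary frame (★ `frame_blk_unitary`): `X = ⅟2(EAE − E)` is `T`-skew and rational, so `n(X)`
is the frame of some `u₀ ∈ N_Δ(L⁺)` (★ `exists_mem_HA_of_cstar`, ★ `mem_ratH_of_frame_eq_map`); `w_χ u₀ γ` has vanishing `C`-block, i.e. lies in `P_Δ`
(★ `isSiegelDelta_iff_conj`); `w_χ² = 1`. [cite: GelbartPiatetskishapiroRallis1987, Part A §§1–2] [cite: KudlaRallis1994, §1] [cite: MoeglinWaldspurger1995, II.1.7] -/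
theorem exists_unip_refl_siegel_of_normalForm (hdV0 : ∀ i, dV i ≠ 0) (hdW0 : ∀ i, dW i ≠ 0) {γ : HA L e dV hdV dW hdW}
    (hγ : γ ∈ ratH L e dV hdV dW hdW) {χ : Fin n → L} (hχ : ∀ k, χ k = 0 ∨ χ k = 1)
    (hC : (Matrix.fromBlocks (1 : Matrix (Fin n) (Fin n) (AdeleRing (𝓞 L) L)) 0 (-1) 1 * blk L e dV hdV dW hdW γ * Matrix.fromBlocks 1 0 1 1).toBlocks₂₁ =
      -((2 : AdeleRing (𝓞 L) L) • Matrix.diagonal (fun i => algebraMap L (AdeleRing (𝓞 L) L) (χ i)))) :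
    ∃ (g : UnitaryGroup.rationalPair (Fp L) L (IsCMField.complexConj L) N M (Matrix.diagonal dV) (Matrix.diagonal dW)) (u p : HA L e dV hdV dW hdW),
      ((g : GL (Fin N × Fin M) L) : Matrix (Fin N × Fin M) (Fin N × Fin M) L) = Matrix.diagonal (fun k => 1 - 2 * χ (e k)) ∧ g * g = 1 ∧
      u ∈ unipDelta L e dV hdV dW hdW ∧ u ∈ ratH L e dV hdV dW hdW ∧ p ∈ ratH L e dV hdV dW hdW ∧ IsSiegelDelta L e dV hdV dW hdW p ∧
      γ = u * iotaGG L e dV hdV dW hdW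
        (1, UnitaryGroup.rationalPairToAdelic (Fp L) L (IsCMField.complexConj L) N M (Matrix.diagonal dV) (Matrix.diagonal dW) g) * p := by
  -- notation-free abbreviations (no `set` on coordinates: all terms are written out)
  obtain ⟨hE, hEσ, hEt, hEJ⟩ := cornerIdem_facts L e dV hdV dW hdW hχ
  have hTu := isUnit_det_gramRA L e dV hdV dW hdW hdV0 hdW0
  have hTσ := gramRA_map_conjAdele L e dV hdV dW hdW
  have hTt := gramRA_transpose L e dV hdV dW hdW
  have hσσ : ∀ x, conjAdele (Fp L) L (IsCMField.complexConj L) (conjAdele (Fp L) L (IsCMField.complexConj L) x) = x := conjAdele_conjAdele' L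
  -- the frame in blocks and its unitarity
  set F : Matrix (Fin n ⊕ Fin n) (Fin n ⊕ Fin n) (AdeleRing (𝓞 L) L) :=
    Matrix.fromBlocks (1 : Matrix (Fin n) (Fin n) (AdeleRing (𝓞 L) L)) 0 (-1) 1 * blk L e dV hdV dW hdW γ * Matrix.fromBlocks 1 0 1 1 with hF
  have hFb : F = Matrix.fromBlocks F.toBlocks₁₁ F.toBlocks₁₂ (-((2 : AdeleRing (𝓞 L) L) • Matrix.diagonal (fun i => algebraMap L (AdeleRing (𝓞 L) L) (χ i))))
      F.toBlocks₂₂ := by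
    rw [← hC, Matrix.fromBlocks_toBlocks]
  have hFu := frame_blk_unitary L e dV hdV dW hdW γ
  rw [← hF, hFb] at hFu
  -- (X3) in the frame
  have hA := corner_mul_eq_zero_of_unitary (conjAdele (Fp L) L (IsCMField.complexConj L)) hσσ hTu hTσ hTt hE hEσ hEt hEJ hFu
  have hXskew := skew_half_corner_of_unitary (conjAdele (Fp L) L (IsCMField.complexConj L)) hE hEσ hEt hEJ hFu
  have hC0 := toBlocks₂₁_reflFrame_mul_unip_mul_eq_zero (B := F.toBlocks₁₂) (D := F.toBlocks₂₂) hE hA (two_smul_corner_half hE F.toBlocks₁₁)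
  -- the unipotent `u₀` with frame `n(X)`, `X = ⅟2 (E A E − E)`
  set X : Matrix (Fin n) (Fin n) (AdeleRing (𝓞 L) L) := (⅟ (2 : AdeleRing (𝓞 L) L)) •
    (Matrix.diagonal (fun i => algebraMap L (AdeleRing (𝓞 L) L) (χ i)) * F.toBlocks₁₁ * Matrix.diagonal (fun i => algebraMap L (AdeleRing (𝓞 L) L) (χ i)) -
      Matrix.diagonal (fun i => algebraMap L (AdeleRing (𝓞 L) L) (χ i))) with hX
  have hnX := unframe_unitary_of_frame_unitary (conjAdele (Fp L) L (IsCMField.complexConj L)) _ ((unip_unitary_iff _ _ X).2 hXskew)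
  have hXY : Matrix.fromBlocks (1 : Matrix (Fin n) (Fin n) (AdeleRing (𝓞 L) L)) 0 1 (1 : Matrix (Fin n) (Fin n) (AdeleRing (𝓞 L) L)) * Matrix.fromBlocks 1 X 0 1 * Matrix.fromBlocks (1 : Matrix (Fin n) (Fin n) (AdeleRing (𝓞 L) L)) 0 (-1) (1 : Matrix (Fin n) (Fin n) (AdeleRing (𝓞 L) L)) *
      (Matrix.fromBlocks (1 : Matrix (Fin n) (Fin n) (AdeleRing (𝓞 L) L)) 0 1 (1 : Matrix (Fin n) (Fin n) (AdeleRing (𝓞 L) L)) * Matrix.fromBlocks 1 (-X) 0 1 * Matrix.fromBlocks (1 : Matrix (Fin n) (Fin n) (AdeleRing (𝓞 L) L)) 0 (-1) (1 : Matrix (Fin n) (Fin n) (AdeleRing (𝓞 L) L))) = 1 := by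
    rw [unframe_unip_mul, add_neg_cancel, Matrix.fromBlocks_one, Matrix.mul_one, E₂_mul_E₁]
  have hYX : Matrix.fromBlocks (1 : Matrix (Fin n) (Fin n) (AdeleRing (𝓞 L) L)) 0 1 (1 : Matrix (Fin n) (Fin n) (AdeleRing (𝓞 L) L)) * Matrix.fromBlocks 1 (-X) 0 1 * Matrix.fromBlocks (1 : Matrix (Fin n) (Fin n) (AdeleRing (𝓞 L) L)) 0 (-1) (1 : Matrix (Fin n) (Fin n) (AdeleRing (𝓞 L) L)) *
      (Matrix.fromBlocks (1 : Matrix (Fin n) (Fin n) (AdeleRing (𝓞 L) L)) 0 1 (1 : Matrix (Fin n) (Fin n) (AdeleRing (𝓞 L) L)) * Matrix.fromBlocks 1 X 0 1 * Matrix.fromBlocks (1 : Matrix (Fin n) (Fin n) (AdeleRing (𝓞 L) L)) 0 (-1) (1 : Matrix (Fin n) (Fin n) (AdeleRing (𝓞 L) L))) = 1 := by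
    rw [unframe_unip_mul, neg_add_cancel, Matrix.fromBlocks_one, Matrix.mul_one, E₂_mul_E₁]
  obtain ⟨u₀, hu₀⟩ := exists_mem_HA_of_cstar L e dV hdV dW hdW hXY hYX hnX
  have hfu₀ : Matrix.fromBlocks (1 : Matrix (Fin n) (Fin n) (AdeleRing (𝓞 L) L)) 0 (-1) 1 * blk L e dV hdV dW hdW u₀ * Matrix.fromBlocks 1 0 1 1 =
      Matrix.fromBlocks 1 X 0 1 := by
    rw [hu₀, frame_unframe]
  have hu₀N : u₀ ∈ unipDelta L e dV hdV dW hdW := (mem_unipDelta_iff L e dV hdV dW hdW u₀).2 ⟨_, hfu₀⟩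
  -- `u₀` is rational: its coordinate is `⅟2 (diag χ · A₀ · diag χ − diag χ) ⊗ 1` for the rational frame `F = F₀ ⊗ 1`
  obtain ⟨F₀, hF₀⟩ := exists_frame_eq_map_of_mem_ratH L e dV hdV dW hdW hγ
  have hu₀r : u₀ ∈ ratH L e dV hdV dW hdW := by
    refine mem_ratH_of_frame_eq_map L e dV hdV dW hdW hdV0 hdW0
      (F₀ := Matrix.fromBlocks 1 ((⅟ (2 : L)) • (Matrix.diagonal χ * F₀.toBlocks₁₁ * Matrix.diagonal χ - Matrix.diagonal χ)) 0 1) ?_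
    rw [hfu₀, hX, Matrix.fromBlocks_map, Matrix.map_one _ (map_zero _) (map_one _), Matrix.map_zero _ (map_zero _),
      Matrix.map_smulₛₗ _ _ (⅟ (2 : L)) (fun a => by rw [smul_eq_mul, smul_eq_mul, map_mul]) _, algebraMap_invOf_two, Matrix.map_sub _ (map_sub _),
      Matrix.map_mul, Matrix.map_mul, Matrix.diagonal_map (map_zero _)]
    have h11 : F.toBlocks₁₁ = F₀.toBlocks₁₁.map (algebraMap L (AdeleRing (𝓞 L) L)) := by
      rw [hF, hF₀]; rfl
    rw [h11]
  -- the reflection `w_χ`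
  obtain ⟨g, hg, hgg⟩ := exists_signInvolution L dV dW (χ := fun k => χ (e k)) fun k => hχ (e k)
  have hwf := frame_iotaGG_signInvolution L e dV hdV dW hdW χ hg
  have hwr := iotaGG_one_mem_ratH L e dV hdV dW hdW g
  have hww : iotaGG L e dV hdV dW hdW (1, UnitaryGroup.rationalPairToAdelic (Fp L) L (IsCMField.complexConj L) N M (Matrix.diagonal dV) (Matrix.diagonal dW) g) *
      iotaGG L e dV hdV dW hdW (1, UnitaryGroup.rationalPairToAdelic (Fp L) L (IsCMField.complexConj L) N M (Matrix.diagonal dV) (Matrix.diagonal dW) g) = 1 :=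
    iotaGG_one_mul_self L e dV hdV dW hdW (by rw [← map_mul, hgg, map_one])
  -- the Siegel factor `p := w_χ u₀ γ`
  have hpP : IsSiegelDelta L e dV hdV dW hdW
      (iotaGG L e dV hdV dW hdW (1, UnitaryGroup.rationalPairToAdelic (Fp L) L (IsCMField.complexConj L) N M (Matrix.diagonal dV) (Matrix.diagonal dW) g) *
        u₀ * γ) := by
    rw [isSiegelDelta_iff_conj, conj_blk_mul, conj_blk_mul, hwf, hfu₀, ← hF, hFb]
    exact hC0
  refine ⟨g, u₀⁻¹, _, hg, hgg, inv_mem hu₀N, inv_mem hu₀r, mul_mem (mul_mem hwr hu₀r) hγ, hpP, ?_⟩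
  calc γ = u₀⁻¹ * (iotaGG L e dV hdV dW hdW (1, UnitaryGroup.rationalPairToAdelic (Fp L) L (IsCMField.complexConj L) N M (Matrix.diagonal dV) (Matrix.diagonal dW) g) *
        iotaGG L e dV hdV dW hdW (1, UnitaryGroup.rationalPairToAdelic (Fp L) L (IsCMField.complexConj L) N M (Matrix.diagonal dV) (Matrix.diagonal dW) g)) *
        u₀ * γ := by rw [hww, mul_one, inv_mul_cancel, one_mul]
    _ = _ := by simp only [mul_assoc]

/-! ## §4 The pointwise exhaustion face (X) -/

/-- **THE FACE (X): BRUHAT EXHAUSTION OFF THE BIG CELL.**  Every `γ ∈ H(L⁺)` whose `C`-block is not invertible is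
`γ = p · w_χ · p'` with `p, p' ∈ P_Δ(L⁺)` (rational and Siegel), `w_χ = ι(1, γ_χ ⊗ 1)` for a rational sign involution `γ_χ = diag(1 − 2χ∘e)`, `γ_χ² = 1`,
and a `0∕1` pattern `χ` WITH A ZERO ENTRY (so `w_χ` is a middle-cell or trivial representative; `χ ≢ 0` when `γ ∉ P_Δ`, `exists_apply_eq_one_of_not_isSiegelDelta`).
Hence `P_Δ(L⁺)\H(L⁺)` is `{[1]} ⊔ [w_Δ N_Δ(L⁺)] ⊔ ⋃_χ {[w_χ p'] : p' ∈ P_Δ(L⁺)}` — the cells of [GPSR87, Part A §1] indexed by `rank C`.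
[cite: GelbartPiatetskishapiroRallis1987, Part A §§1–2] [cite: KudlaRallis1994, §1] [cite: MoeglinWaldspurger1995, II.1.7] -/
theorem exists_siegel_mul_refl_mul_siegel (hdV0 : ∀ i, dV i ≠ 0) (hdW0 : ∀ i, dW i ≠ 0) {γ : HA L e dV hdV dW hdW} (hγ : γ ∈ ratH L e dV hdV dW hdW)
    (hn : ¬ IsUnit (Matrix.fromBlocks (1 : Matrix (Fin n) (Fin n) (AdeleRing (𝓞 L) L)) 0 (-1) 1 * blk L e dV hdV dW hdW γ * Matrix.fromBlocks 1 0 1 1).toBlocks₂₁.det) :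
    ∃ (g : UnitaryGroup.rationalPair (Fp L) L (IsCMField.complexConj L) N M (Matrix.diagonal dV) (Matrix.diagonal dW)) (χ : Fin n → L)
      (p p' : HA L e dV hdV dW hdW), (∀ k, χ k = 0 ∨ χ k = 1) ∧ (∃ k, χ k = 0) ∧
      ((g : GL (Fin N × Fin M) L) : Matrix (Fin N × Fin M) (Fin N × Fin M) L) = Matrix.diagonal (fun k => 1 - 2 * χ (e k)) ∧ g * g = 1 ∧
      p ∈ ratH L e dV hdV dW hdW ∧ IsSiegelDelta L e dV hdV dW hdW p ∧ p' ∈ ratH L e dV hdV dW hdW ∧ IsSiegelDelta L e dV hdV dW hdW p' ∧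
      γ = p * iotaGG L e dV hdV dW hdW
        (1, UnitaryGroup.rationalPairToAdelic (Fp L) L (IsCMField.complexConj L) N M (Matrix.diagonal dV) (Matrix.diagonal dW) g) * p' := by
  obtain ⟨χ, m₁, m₂, hχ, hm₁r, hm₁P, hm₂r, hm₂P, hC, hk⟩ := exists_siegel_conj_normalForm L e dV hdV dW hdW hdV0 hdW0 hγ
  obtain ⟨g, u, p₂, hg, hgg, huN, hur, hp₂r, hp₂P, hγ'⟩ :=
    exists_unip_refl_siegel_of_normalForm L e dV hdV dW hdW hdV0 hdW0 (mul_mem (mul_mem hm₁r hγ) hm₂r) hχ hC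
  refine ⟨g, χ, m₁⁻¹ * u, p₂ * m₂⁻¹, hχ, hk hn, hg, hgg, mul_mem (inv_mem hm₁r) hur,
    isSiegelDelta_mul L e dV hdV dW hdW (isSiegelDelta_inv L e dV hdV dW hdW hm₁P) (isSiegelDelta_of_mem_unipDelta L e dV hdV dW hdW huN),
    mul_mem hp₂r (inv_mem hm₂r), isSiegelDelta_mul L e dV hdV dW hdW hp₂P (isSiegelDelta_inv L e dV hdV dW hdW hm₂P), ?_⟩
  calc γ = m₁⁻¹ * (m₁ * γ * m₂) * m₂⁻¹ := by simp only [mul_assoc, mul_inv_cancel, mul_one, inv_mul_cancel_left]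
    _ = _ := by simp only [hγ', mul_assoc]

/-- `1 − G = 2·diag(χ ⊗ 1)` for the adelic block `G = reindex e (γ_χ ⊗ 1)` of `w_χ` — the bridge to the corner condition `diag(χ) X diag(χ) = 0` of ★ Φ2
files 4–5 (`(1 − G) X (1 − G) = 4 · diag(χ) X diag(χ)`). [folklore] -/
theorem one_sub_reindex_signInvolution {g : UnitaryGroup.rationalPair (Fp L) L (IsCMField.complexConj L) N M (Matrix.diagonal dV) (Matrix.diagonal dW)}
    {χ : Fin n → L} (hg : ((g : GL (Fin N × Fin M) L) : Matrix (Fin N × Fin M) (Fin N × Fin M) L) = Matrix.diagonal (fun k => 1 - 2 * χ (e k))) :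
    1 - Matrix.reindex e e (((UnitaryGroup.rationalPairToAdelic (Fp L) L (IsCMField.complexConj L) N M (Matrix.diagonal dV) (Matrix.diagonal dW) g :
        UnitaryGroup.adelicPair (Fp L) L (IsCMField.complexConj L) N M (Matrix.diagonal dV) (Matrix.diagonal dW)) :
        GL (Fin N × Fin M) (AdeleRing (𝓞 L) L)) : Matrix (Fin N × Fin M) (Fin N × Fin M) (AdeleRing (𝓞 L) L)) =
      (2 : AdeleRing (𝓞 L) L) • Matrix.diagonal (fun i => algebraMap L (AdeleRing (𝓞 L) L) (χ i)) := by
  rw [UnitaryGroup.coe_rationalPairToAdelic, reindex_signInvolution L e χ hg, sub_sub_cancel]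

/-- **off `P_Δ` the pattern is non-zero**: in the factorisation `γ = p · w_χ · p'`, if `γ ∉ P_Δ` then `χ k = 1` for some `k` (otherwise `G = 1`, `w_χ ∈ P_Δ` and
`γ ∈ P_Δ`). [cite: GelbartPiatetskishapiroRallis1987, Part A §1] -/
theorem exists_apply_eq_one_of_not_isSiegelDelta {g : UnitaryGroup.rationalPair (Fp L) L (IsCMField.complexConj L) N M (Matrix.diagonal dV) (Matrix.diagonal dW)}
    {χ : Fin n → L} (hχ : ∀ k, χ k = 0 ∨ χ k = 1)
    (hg : ((g : GL (Fin N × Fin M) L) : Matrix (Fin N × Fin M) (Fin N × Fin M) L) = Matrix.diagonal (fun k => 1 - 2 * χ (e k)))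
    {γ p p' : HA L e dV hdV dW hdW} (hp : IsSiegelDelta L e dV hdV dW hdW p) (hp' : IsSiegelDelta L e dV hdV dW hdW p')
    (h : γ = p * iotaGG L e dV hdV dW hdW
        (1, UnitaryGroup.rationalPairToAdelic (Fp L) L (IsCMField.complexConj L) N M (Matrix.diagonal dV) (Matrix.diagonal dW) g) * p')
    (h0 : ¬ IsSiegelDelta L e dV hdV dW hdW γ) : ∃ k, χ k = 1 := by
  by_contra hne
  simp only [not_exists] at hne
  have hχ0 : ∀ k, χ k = 0 := fun k => (hχ k).resolve_right (hne k)
  apply h0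
  rw [h]
  refine isSiegelDelta_mul L e dV hdV dW hdW (isSiegelDelta_mul L e dV hdV dW hdW hp ?_) hp'
  rw [isSiegelDelta_iff_conj, frame_iotaGG_signInvolution L e dV hdV dW hdW χ hg, Matrix.toBlocks_fromBlocks₂₁]
  have hE : Matrix.diagonal (fun i => algebraMap L (AdeleRing (𝓞 L) L) (χ i)) = 0 := by
    rw [← Matrix.diagonal_zero]; congr 1; funext i; rw [hχ0 i, map_zero]
  rw [hE, smul_zero, neg_zero]

/-! ## §5 The rational big cell -/

/-- **THE RATIONAL BIG CELL**: `γ ∈ H(L⁺)` with `det C(γ) ∈ 𝔸_L^×` is `γ = p · w_Δ · ν` with `p ∈ P_Δ(L⁺)` and `ν ∈ N_Δ(L⁺)` — ★ adelic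
`exists_siegel_weylDelta_unip`, whose `N_Δ`-coordinate `X = C⁻¹D − ⅟2` is rational (★ `mem_ratH_of_frame_eq_map`), and `w_Δ ∈ H(L⁺)` (★ `weylDelta_mem_ratH`).
So the cosets of `P_Δ(L⁺)\H(L⁺)` off `{[1]} ∪ [w_Δ N_Δ(L⁺)]` are exactly those with `det C = 0`, `C ≠ 0`. [cite: GelbartPiatetskishapiroRallis1987, Part A §§1–2]
[cite: KudlaRallis1994, §1] -/
theorem exists_rat_siegel_weylDelta_unip (hdV0 : ∀ i, dV i ≠ 0) (hdW0 : ∀ i, dW i ≠ 0) {γ : HA L e dV hdV dW hdW} (hγ : γ ∈ ratH L e dV hdV dW hdW)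
    (hC : IsUnit (Matrix.fromBlocks (1 : Matrix (Fin n) (Fin n) (AdeleRing (𝓞 L) L)) 0 (-1) 1 * blk L e dV hdV dW hdW γ * Matrix.fromBlocks 1 0 1 1).toBlocks₂₁.det) :
    ∃ p ν : HA L e dV hdV dW hdW, p ∈ ratH L e dV hdV dW hdW ∧ IsSiegelDelta L e dV hdV dW hdW p ∧ ν ∈ unipDelta L e dV hdV dW hdW ∧ ν ∈ ratH L e dV hdV dW hdW ∧
      γ = p * weylDelta L e dV hdV dW hdW * ν := by
  obtain ⟨p, ν, hp, hν, hγe, hfν⟩ := exists_siegel_weylDelta_unip L e dV hdV dW hdW hdV0 hdW0 γ hC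
  obtain ⟨F₀, hF₀⟩ := exists_frame_eq_map_of_mem_ratH L e dV hdV dW hdW hγ
  have hFb : F₀.map (algebraMap L (AdeleRing (𝓞 L) L)) = Matrix.fromBlocks (F₀.toBlocks₁₁.map (algebraMap L (AdeleRing (𝓞 L) L)))
      (F₀.toBlocks₁₂.map (algebraMap L (AdeleRing (𝓞 L) L))) (F₀.toBlocks₂₁.map (algebraMap L (AdeleRing (𝓞 L) L)))
      (F₀.toBlocks₂₂.map (algebraMap L (AdeleRing (𝓞 L) L))) := by
    rw [← Matrix.fromBlocks_map, Matrix.fromBlocks_toBlocks]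
  -- `det C₀ ≠ 0` over the field `L`
  have hC₀ : IsUnit F₀.toBlocks₂₁.det := by
    rw [hF₀, hFb, Matrix.toBlocks_fromBlocks₂₁] at hC
    rw [isUnit_iff_ne_zero]
    intro h0
    have h := hC
    rw [← RingHom.mapMatrix_apply, ← RingHom.map_det, h0, map_zero] at h
    obtain ⟨w, hw⟩ := h
    have h01 : algebraMap L (AdeleRing (𝓞 L) L) 0 = algebraMap L (AdeleRing (𝓞 L) L) 1 := by
      rw [map_zero, map_one, ← w.mul_inv, hw, zero_mul]
    exact zero_ne_one (AdeleRing.algebraMap_injective (𝓞 L) L h01)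
  have hνr : ν ∈ ratH L e dV hdV dW hdW := by
    refine mem_ratH_of_frame_eq_map L e dV hdV dW hdW hdV0 hdW0
      (F₀ := Matrix.fromBlocks 1 (F₀.toBlocks₂₁⁻¹ * F₀.toBlocks₂₂ - (⅟ (2 : L)) • 1) 0 1) ?_
    rw [hfν, hF₀, hFb, Matrix.toBlocks_fromBlocks₂₁, Matrix.toBlocks_fromBlocks₂₂, Matrix.fromBlocks_map, Matrix.map_one _ (map_zero _) (map_one _),
      Matrix.map_zero _ (map_zero _), Matrix.map_sub _ (map_sub _), Matrix.map_mul, map_nonsing_inv_of_isUnit _ hC₀,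
      Matrix.map_smulₛₗ _ _ (⅟ (2 : L)) (fun a => by rw [smul_eq_mul, smul_eq_mul, map_mul]) _, Matrix.map_one _ (map_zero _) (map_one _),
      algebraMap_invOf_two]
  have hpr : p ∈ ratH L e dV hdV dW hdW := by
    have hpe : p = γ * ν⁻¹ * (weylDelta L e dV hdV dW hdW)⁻¹ := by
      rw [hγe, mul_inv_cancel_right, mul_inv_cancel_right]
    rw [hpe]
    exact mul_mem (mul_mem hγ (inv_mem hνr)) (inv_mem (weylDelta_mem_ratH L e dV hdV dW hdW))
  exact ⟨p, ν, hpr, (mem_siegelDelta_iff L e dV hdV dW hdW p).1 hp, hν, hνr, hγe⟩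

end Summit.HodgeConjecture.HodgeConjecture.Cruxes.HLiu418.K2LiuSiegelBruhatMiddleCellExhaustion

end
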